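import Summits.ABC.IUTFork.Thm311RealInd1UnitsShearCore
import HarnessLib

/-!
# The unit-group shear at `v₇ = (√7)` of `ℚ(√7)`, II: ANALYTIC TOOLKIT — `log(𝒪^×) = B(0,‖Ω‖)`,
# the exponential on the log-ball, and the coordinate norm/trace formulas

Record file (D-0012) of the abc-iut cell (TEAM R, lead seat abc-iut-c312-14 = R1, gen 7); sequel of
`Thm311RealInd1UnitsShearCore.lean`; TAKES NO SIDE on [IUTchIII] Cor. 3.12.

CONTENT (all classical `p`-adic analysis at the tame quadratically ramified `K₇`, `p = 7`, `e = 2 ≤ p − 2`):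
* `logUnits_eq_ball` — `log₇(𝒪^×) = B(0, ‖Ω‖)` ([IUTchIV] Prop. 1.2 (i) equality clause,
  abc-iut-S1's `prop12iEq_holds`);
* `theta_rad1_lt_one` / `theta_rad2_lt_one` — the contraction moduli `‖Ω‖·7^{1/6} = 7^{-1/3} < 1` and
  `‖Ω‖²·7^{1/6} = 7^{-5/6} < 1` (so `logSeries` is a bijection `1 + B(0,ρ) → B(0,ρ)` at `ρ = ‖Ω‖, ‖Ω‖²`);
* `expB` — THE inverse (`exists_logSeries_eq`, choice) on the log-ball, with `expB_spec`, `norm_expB`,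
  `expB_mul`, `expB_neg`, `expB_zero`, `unitLog_expB`;
* `repr_combo`, `norm_coords` (`N(a·1 + b·Ω) = a² − 7b²`, `leftMulMatrix` determinant),
  `trace_omega`/`trace_smul_omega` (`Tr(c·Ω) = 0`), `norm_seven_K7` (`‖7‖ = ‖Ω‖²`).

[cite: NeukirchANT1999, Ch. II Prop. (5.5)] [cite: Koblitz1984, Ch. IV §1–2] [folklore] throughout;
[claim: Mochizuki2012, status: disputed] for the [IUTchIV] locution.  Nothing here asserts or refutes
[IUTchIII] Cor. 3.12.
-/

set_option autoImplicit false

noncomputable section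

namespace Summit.ABC.IUTFork.Thm311.Real.UnitsShear

open Literature.IUT.LogVolume Literature.NumberTheory.NumberFields
open NumberField IsDedekindDomain Metric IsUltrametricDist
open Summit.ABC.IUTFork.RamifiedMover
open Summit.ABC.IUTFork.Thm311.Real

/-! ## 1. `log₇(𝒪^×) = B(0, ‖Ω‖)` (tame equality clause) -/

/-- `e(K₇/ℚ₇) = 2` for abc-iut-S1's abstract ramification index. [folklore] -/
theorem absRamificationIdx_K7 : absRamificationIdx 7 K7 = 2 :=
  (absRamificationIdx_rescaledCompletion ↥F7 7 v7 seven_mem_v7).trans ramificationIdx_v7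

/-- `‖Ω‖ = 7^{-1/2}` (real `rpow`). [folklore] -/
theorem norm_omega_rpow : ‖Omega‖ = ((7 : ℕ) : ℝ) ^ (-(2⁻¹ : ℝ)) := by
  have h0 : (0 : ℝ) ≤ ‖Omega‖ := norm_nonneg _
  have hpos : (0 : ℝ) < ((7 : ℕ) : ℝ) ^ (-(2⁻¹ : ℝ)) := Real.rpow_pos_of_pos (by norm_num) _
  have hsq2 : (((7 : ℕ) : ℝ) ^ (-(2⁻¹ : ℝ))) ^ 2 = (((7 : ℕ) : ℝ))⁻¹ := by
    rw [pow_two, ← Real.rpow_add (by norm_num : (0:ℝ) < ((7:ℕ):ℝ)),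
      show (-(2⁻¹:ℝ) + -(2⁻¹:ℝ)) = (-1:ℝ) by norm_num, Real.rpow_neg_one]
  have key : ‖Omega‖ ^ 2 = (((7 : ℕ) : ℝ) ^ (-(2⁻¹ : ℝ))) ^ 2 := by rw [norm_omega_sq, hsq2]
  refine le_antisymm ?_ ?_
  · nlinarith [key, h0, hpos]
  · nlinarith [key, h0, hpos]

/-- **`log₇(𝒪^×) = B(0, ‖Ω‖)`** — [IUTchIV] Prop. 1.2 (i), equality clause, at the tame quadratically
ramified `K₇` (`p = 7 > 2`, `e = 2 ≤ 5 = p − 2`; abc-iut-S1's `prop12iEq_holds`). [claim: Mochizuki2012, status: disputed] -/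
theorem logUnits_eq_ball : logUnits K7 = closedBall (0 : K7) ‖Omega‖ := by
  have h := (prop12iEq_holds 7 K7 (by norm_num) (by rw [absRamificationIdx_K7]; norm_num)).1
  rw [← h, pBall_eq_closedBall, absRamificationIdx_K7,
    logRadiusA_eq (by norm_num) (by norm_num) (by norm_num : (2:ℕ) ≤ 7 - 2)]
  rw [norm_omega_rpow]
  congr 1
  norm_num

/-! ## 2. The contraction moduli -/

/-- `7^{1/6} > 0`. [folklore] -/
theorem rpow_sixth_pos : 0 < ((7 : ℕ) : ℝ) ^ (1 / ((7 : ℝ) - 1)) :=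
  Real.rpow_pos_of_pos (by norm_num) _

/-- **`θ₁ := ‖Ω‖ · 7^{1/6} = 7^{-1/3} < 1`** — the contraction modulus at radius `‖Ω‖`. [folklore] -/
theorem theta_rad1_lt_one : ‖Omega‖ * ((7 : ℕ) : ℝ) ^ (1 / ((7 : ℝ) - 1)) < 1 := by
  rw [norm_omega_rpow]
  rw [← Real.rpow_add (by norm_num : (0:ℝ) < ((7:ℕ):ℝ))]
  refine Real.rpow_lt_one_of_one_lt_of_neg (by norm_num) (by norm_num)

/-- **`θ₂ := ‖Ω‖² · 7^{1/6} = 7^{-5/6} < 1`** — the contraction modulus at radius `‖Ω‖²`. [folklore] -/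
theorem theta_rad2_lt_one : ‖Omega‖ ^ 2 * ((7 : ℕ) : ℝ) ^ (1 / ((7 : ℝ) - 1)) < 1 := by
  rw [norm_omega_sq]
  rw [show (((7:ℕ):ℝ))⁻¹ = ((7:ℕ):ℝ) ^ (-1 : ℝ) by rw [Real.rpow_neg_one]]
  rw [← Real.rpow_add (by norm_num : (0:ℝ) < ((7:ℕ):ℝ))]
  refine Real.rpow_lt_one_of_one_lt_of_neg (by norm_num) (by norm_num)

/-- The contraction modulus in `ℚ₇` at radius `7⁻¹`: `7⁻¹·7^{1/6} < 1`. [folklore] -/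
theorem theta_q7_lt_one : (((7 : ℕ) : ℝ))⁻¹ * ((7 : ℕ) : ℝ) ^ (1 / ((7 : ℝ) - 1)) < 1 := by
  rw [show (((7:ℕ):ℝ))⁻¹ = ((7:ℕ):ℝ) ^ (-1 : ℝ) by rw [Real.rpow_neg_one]]
  rw [← Real.rpow_add (by norm_num : (0:ℝ) < ((7:ℕ):ℝ))]
  refine Real.rpow_lt_one_of_one_lt_of_neg (by norm_num) (by norm_num)

/-! ## 3. The exponential on the log-ball -/

/-- **`exp` on the log-ball `B(0, ‖Ω‖)`**: THE section of `logSeries` there (successive approximation,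
abc-iut-S1's `exists_logSeries_eq`; junk value `1` off the ball). [cite: Koblitz1984, Ch. IV §2] -/
def expB (z : K7) : K7 :=
  if h : ‖z‖ ≤ ‖Omega‖ then (exists_logSeries_eq 7 K7 theta_rad1_lt_one h).choose else 1

/-- `expB` lands in `1 + B(0, ‖Ω‖)` and is a section of `logSeries`. [cite: Koblitz1984, Ch. IV §2] -/
theorem expB_spec {z : K7} (hz : ‖z‖ ≤ ‖Omega‖) :
    ‖1 - expB z‖ ≤ ‖Omega‖ ∧ logSeries (expB z) = z := by
  rw [expB, dif_pos hz]
  exact (exists_logSeries_eq 7 K7 theta_rad1_lt_one hz).choose_spec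

/-- `expB z` is a principal unit. [folklore] -/
theorem isPrincipal_expB {z : K7} (hz : ‖z‖ ≤ ‖Omega‖) : IsPrincipal (expB z) :=
  lt_of_le_of_lt (expB_spec hz).1 norm_omega_pos_lt_one.2

/-- A point at distance `< 1` from `1` has norm `1` (ultrametric). [folklore] -/
theorem norm_eq_one_of_norm_one_sub_lt {y : K7} (hlt : ‖1 - y‖ < 1) : ‖y‖ = 1 := by
  have hle : ‖y‖ ≤ 1 := by
    have := norm_add_le_max (y - 1) 1
    rw [sub_add_cancel] at this
    refine this.trans (max_le ?_ norm_one.le)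
    rw [← norm_neg, neg_sub]
    exact hlt.le
  rcases lt_or_eq_of_le hle with h | h
  · exfalso
    have := norm_add_le_max (1 - y) y
    rw [sub_add_cancel] at this
    rw [norm_one] at this
    have hmax : max ‖1 - y‖ ‖y‖ < 1 := max_lt hlt h
    exact absurd (this.trans_lt hmax) (lt_irrefl 1)
  · exact h

/-- `‖expB z‖ = 1`. [folklore] -/
theorem norm_expB {z : K7} (hz : ‖z‖ ≤ ‖Omega‖) : ‖expB z‖ = 1 :=
  norm_eq_one_of_norm_one_sub_lt (lt_of_le_of_lt (expB_spec hz).1 norm_omega_pos_lt_one.2)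

/-- `unitLog (expB z) = z` on the ball. [folklore] -/
theorem unitLog_expB {z : K7} (hz : ‖z‖ ≤ ‖Omega‖) : unitLog (expB z) = z := by
  rw [unitLog_of_isPrincipal 7 (isPrincipal_expB hz), (expB_spec hz).2]

/-- `expB 0 = 1`. [folklore] -/
theorem expB_zero : expB (0 : K7) = 1 := by
  have h0 : ‖(0 : K7)‖ ≤ ‖Omega‖ := by rw [norm_zero]; exact norm_omega_pos_lt_one.1.le
  refine logSeries_injOn 7 K7 theta_rad1_lt_one ?_ ?_ ?_
  · exact (expB_spec h0).1
  · show ‖1 - (1 : K7)‖ ≤ ‖Omega‖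
    rw [sub_self, norm_zero]
    exact norm_omega_pos_lt_one.1.le
  · rw [(expB_spec h0).2, logSeries_one]

/-- **`expB` is a homomorphism on the ball**: `expB (z + w) = expB z · expB w`. [folklore] -/
theorem expB_add {z w : K7} (hz : ‖z‖ ≤ ‖Omega‖) (hw : ‖w‖ ≤ ‖Omega‖) :
    expB (z + w) = expB z * expB w := by
  have hzw : ‖z + w‖ ≤ ‖Omega‖ := (norm_add_le_max z w).trans (max_le hz hw)
  have hP : IsPrincipal (expB z * expB w) := (isPrincipal_expB hz).mul (isPrincipal_expB hw)
  refine logSeries_injOn 7 K7 theta_rad1_lt_one ?_ ?_ ?_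
  · exact (expB_spec hzw).1
  · show ‖1 - expB z * expB w‖ ≤ ‖Omega‖
    have h1 : (1 : K7) - expB z * expB w = (1 - expB z) * expB w + (1 - expB w) := by ring
    rw [h1]
    refine (norm_add_le_max _ _).trans (max_le ?_ (expB_spec hw).1)
    rw [norm_mul, norm_expB hw, mul_one]
    exact (expB_spec hz).1
  · rw [(expB_spec hzw).2, logSeries_mul 7 (isPrincipal_expB hz) (isPrincipal_expB hw),
      (expB_spec hz).2, (expB_spec hw).2]

/-- `expB (−z) = (expB z)⁻¹`. [folklore] -/
theorem expB_neg {z : K7} (hz : ‖z‖ ≤ ‖Omega‖) : expB (-z) = (expB z)⁻¹ := by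
  have hnz : ‖(-z : K7)‖ ≤ ‖Omega‖ := by rwa [norm_neg]
  have h0 : expB z ≠ 0 := by
    intro h
    have := norm_expB hz
    rw [h, norm_zero] at this
    norm_num at this
  have hinv : ‖1 - (expB z)⁻¹‖ ≤ ‖Omega‖ := by
    have h1 : (1 : K7) - (expB z)⁻¹ = (expB z)⁻¹ * (expB z - 1) := by
      field_simp
    rw [h1, norm_mul, norm_inv, norm_expB hz, inv_one, one_mul, ← norm_neg, neg_sub]
    exact (expB_spec hz).1
  refine logSeries_injOn 7 K7 theta_rad1_lt_one ?_ hinv ?_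
  · exact (expB_spec hnz).1
  · rw [(expB_spec hnz).2]
    have h := unitLog_inv 7 (norm_expB hz)
    rw [unitLog_of_isPrincipal 7 (isPrincipal_expB hz), (expB_spec hz).2] at h
    rw [← h, unitLog_of_isPrincipal 7]
    exact lt_of_le_of_lt hinv norm_omega_pos_lt_one.2

/-! ## 4. Coordinate formulas: `‖7‖ = ‖Ω‖²`, `repr`, norm and trace -/

/-- `‖(7 : K₇)‖ = ‖Ω‖²`. [folklore] -/
theorem norm_seven_K7 : ‖(7 : K7)‖ = ‖Omega‖ ^ 2 := by
  rw [← omega_sq, norm_pow]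

/-- Coordinates of `a·1 + b·Ω`: `repr 0 = a`, `repr 1 = b`. [folklore] -/
theorem repr_combo (a b : ℚ_[7]) :
    bs7.repr (a • (1 : K7) + b • Omega) 0 = a ∧ bs7.repr (a • (1 : K7) + b • Omega) 1 = b := by
  have h : a • (1 : K7) + b • Omega = a • bs7 0 + b • bs7 1 := by rw [bs7_zero, bs7_one]
  rw [h, map_add, map_smul, map_smul, bs7.repr_self, bs7.repr_self]
  constructor <;> simp

/-- Coordinates of `(7 : K₇)`: `(7, 0)`. [folklore] -/
theorem repr_seven : bs7.repr (7 : K7) 0 = 7 ∧ bs7.repr (7 : K7) 1 = 0 := by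
  have h : (7 : K7) = (7 : ℚ_[7]) • (1 : K7) + (0 : ℚ_[7]) • Omega := by
    rw [zero_smul, add_zero, Algebra.smul_def, map_ofNat, mul_one]
  rw [h]
  exact repr_combo 7 0

/-- The shear coefficient of `(7 : K₇)` is `1`. [folklore] -/
theorem dcoef_seven : dcoef (7 : K7) = 1 := by
  rw [dcoef, repr_seven.1, repr_seven.2]
  norm_num

/-- **The norm in coordinates**: `N_{K₇/ℚ₇}(a·1 + b·Ω) = a² − 7·b²` (`leftMulMatrix` determinant).
[folklore] -/
theorem norm_coords (x : K7) :
    Algebra.norm ℚ_[7] x = (bs7.repr x 0) ^ 2 - 7 * (bs7.repr x 1) ^ 2 := by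
  haveI : FiniteDimensional ℚ_[7] K7 := Module.finite_of_finrank_eq_succ finrank_K7
  rw [Algebra.norm_eq_matrix_det bs7 x]
  have h00 : Algebra.leftMulMatrix bs7 x 0 0 = bs7.repr x 0 := by
    rw [Algebra.leftMulMatrix_eq_repr_mul, bs7_zero, mul_one]
  have h10 : Algebra.leftMulMatrix bs7 x 1 0 = bs7.repr x 1 := by
    rw [Algebra.leftMulMatrix_eq_repr_mul, bs7_zero, mul_one]
  have hxo : x * Omega = (7 * bs7.repr x 1) • (1 : K7) + (bs7.repr x 0) • Omega := by
    conv_lhs => rw [decomp x]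
    rw [add_mul, smul_mul_assoc, one_mul, smul_mul_assoc, ← sq, omega_sq]
    rw [show (7 : K7) = (7 : ℚ_[7]) • (1 : K7) by rw [Algebra.smul_def, map_ofNat, mul_one]]
    rw [smul_smul, add_comm, mul_comm]
  have h01 : Algebra.leftMulMatrix bs7 x 0 1 = 7 * bs7.repr x 1 := by
    rw [Algebra.leftMulMatrix_eq_repr_mul, bs7_one, hxo, (repr_combo _ _).1]
  have h11 : Algebra.leftMulMatrix bs7 x 1 1 = bs7.repr x 0 := by
    rw [Algebra.leftMulMatrix_eq_repr_mul, bs7_one, hxo, (repr_combo _ _).2]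
  rw [Matrix.det_fin_two, h00, h10, h01, h11]
  ring

/-- **The trace in coordinates**: `Tr_{K₇/ℚ₇}(a·1 + b·Ω) = 2a`; in particular `Tr(c·Ω) = 0`. [folklore] -/
theorem trace_coords (x : K7) : Algebra.trace ℚ_[7] K7 x = 2 * bs7.repr x 0 := by
  haveI : FiniteDimensional ℚ_[7] K7 := Module.finite_of_finrank_eq_succ finrank_K7
  rw [Algebra.trace_eq_matrix_trace bs7 x]
  have h00 : Algebra.leftMulMatrix bs7 x 0 0 = bs7.repr x 0 := by
    rw [Algebra.leftMulMatrix_eq_repr_mul, bs7_zero, mul_one]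
  have hxo : x * Omega = (7 * bs7.repr x 1) • (1 : K7) + (bs7.repr x 0) • Omega := by
    conv_lhs => rw [decomp x]
    rw [add_mul, smul_mul_assoc, one_mul, smul_mul_assoc, ← sq, omega_sq]
    rw [show (7 : K7) = (7 : ℚ_[7]) • (1 : K7) by rw [Algebra.smul_def, map_ofNat, mul_one]]
    rw [smul_smul, add_comm, mul_comm]
  have h11 : Algebra.leftMulMatrix bs7 x 1 1 = bs7.repr x 0 := by
    rw [Algebra.leftMulMatrix_eq_repr_mul, bs7_one, hxo, (repr_combo _ _).2]
  rw [Matrix.trace_fin_two, h00, h11]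
  ring

/-- **`Tr(c·Ω) = 0`** — the defect directions are trace-free. [folklore] -/
theorem trace_smul_omega (c : ℚ_[7]) : Algebra.trace ℚ_[7] K7 (c • Omega) = 0 := by
  rw [trace_coords, (repr_smul_omega c).1]
  ring

end Summit.ABC.IUTFork.Thm311.Real.UnitsShear

end
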